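import Summits.SmoothPoincare4.SmoothPoincare4.Theorems.EntropyRungSubcylindricalExistenceCapRealisation
import Summits.SmoothPoincare4.SmoothPoincare4.Theorems.EntropyRungSubcylindricalExistenceCapFloor
import Summits.SmoothPoincare4.SmoothPoincare4.Theorems.EntropyRungSubcylindricalExistenceCappedSobolev
import Summits.SmoothPoincare4.SmoothPoincare4.Theorems.EntropyRungSubcylindricalExistenceCapProfile
import Summits.SmoothPoincare4.SmoothPoincare4.Theorems.EntropyRungSubcylindricalExistenceCutoffFamily
import Summits.SmoothPoincare4.SmoothPoincare4.Theorems.EntropyRungSubcylindricalExistenceCutoffFamilyZoneIntegrable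
import Summits.SmoothPoincare4.SmoothPoincare4.Theorems.EntropyRungSubcylindricalExistenceSmoothedConeModel
import Summits.SmoothPoincare4.SmoothPoincare4.Theorems.EntropyRungSubcylindricalExistenceAnnulusConeFloor
import Summits.SmoothPoincare4.SmoothPoincare4.Theorems.EntropyRungSubcylindricalExistenceLocalisationPrinciple
import Summits.SmoothPoincare4.SmoothPoincare4.Theorems.EntropyRungSubcylindricalExistenceClauseDictionary
import Summits.SmoothPoincare4.SmoothPoincare4.Theorems.EntropyRungSubcylindricalExistenceCutoffAbsorption
import Summits.SmoothPoincare4.SmoothPoincare4.Theorems.EntropyRungSubcylindricalExistenceRoundProfileCurvature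
import Summits.SmoothPoincare4.SmoothPoincare4.Theorems.EntropyRungSubcylindricalExistenceCapPieceFloor
import Summits.SmoothPoincare4.SmoothPoincare4.Theorems.EntropyRungSubcylindricalExistenceCorePieceFloor
import Summits.SmoothPoincare4.SmoothPoincare4.Theorems.EntropyRungSubcylindricalExistenceAnnulusPiece
import Summits.SmoothPoincare4.SmoothPoincare4.Theorems.EntropyRungSubcylindricalExistenceConeCappingParams
import Summits.SmoothPoincare4.SmoothPoincare4.Theorems.EntropyRungSubcylindricalExistenceConeCappingChart
import HarnessLib

/-!
# Cone capping — stub K `stub_coneCapping` of line `fat-conical-core-avr-logsobolev`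
(crux `EntropyRung.SubcylindricalExistence`, stmt-SmoothPoincare4-10871): the assembly

Given a metric `g` on the compact `M`, Euclidean in the chart at `p`, with exact cone factor `Λ` and the
core floor `FloorM g Λ (3 log c)` (test functions vanishing near `p`), we cap the cone conformally:
`G = Φ² g` with `Φ = prof(ρ²)` in the chart (round cap `2Aa/(a²+s)` up to `s_J`, slow opening, exact
cone from `s_c` on) and `Φ = Λ` elsewhere (`helper_capProfile`, `helper_capRealisation`), so that
`R_G ≥ 0`, `R_G(p) > 0`. The entropy clause for `G` at level `min (3 log c) (log 6 − 2) − ε` is then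
assembled from the three kinds of piece floors (cap: `helper_capFloor`/`helper_capPieceFloor`; annuli:
`helper_annulusPiece`, fed by the Euclidean exact-cone floor `helper_annulusConeFloor` of the BKT
log-Sobolev inequality on the smoothed cone `helper_smoothedConeModel`; core: `helper_corePieceFloor`)
through the logarithmic cut-off family `helper_cutoffFamily`, the local Yamabe–Sobolev absorption of
the cut-off cost `helper_cutoffAbsorptionI` (Sobolev constant uniform in the conformal class,
`helper_cappedSobolevUniform`), the IMS localisation principle `helper_localisationPrinciple`, and the
dictionary `helper_clauseDictionary` between the weighted clause on `g` and the clause of `G`.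
-/

noncomputable section

open scoped Manifold ContDiff Topology ENNReal NNReal RealInnerProductSpace
set_option linter.dupNamespace false
open Set Filter Function MeasureTheory
open Literature.Geometry.Lorentzian Literature.Geometry.Riemannian

namespace Summit.SmoothPoincare4.SmoothPoincare4.Theorems

namespace ConeCappingAssembly

/-- `exp u ^ 2 = exp (2u)`. -/
theorem exp_sq (u : ℝ) : Real.exp u ^ 2 = Real.exp (2 * u) := by
  rw [← Real.exp_nat_mul]; norm_num

/-- `(exp u · exp v)² = exp (2u + 2v)`. -/
theorem exp_mul_exp_sq (u v : ℝ) : (Real.exp u * Real.exp v) ^ 2 = Real.exp (2 * u + 2 * v) := by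
  rw [← Real.exp_add, exp_sq]; ring_nf

/-- Index arithmetic on the exponential grid: `exp (T₀ + u ℓ₀) ≤ exp (T₀ + v ℓ₀ + ℓ₀)` forces
`u ≤ v + 1`. -/
theorem le_of_exp_grid_le {T₀ ℓ₀ u v : ℝ} (hℓ : 0 < ℓ₀)
    (h : Real.exp (T₀ + u * ℓ₀) ≤ Real.exp (T₀ + v * ℓ₀ + ℓ₀)) : u ≤ v + 1 := by
  have h1 := Real.exp_le_exp.1 h
  nlinarith

end ConeCappingAssembly

open ConeCappingAssembly in
set_option maxHeartbeats 1600000 in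
-- the statement alone is ~3000 characters of binders; elaborating it and the 17 helper applications
-- exceeds the default budget
/-- **Stub K (`stub_coneCapping`) of line `fat-conical-core-avr-logsobolev`.** Conformal capping of the
exact cone: from the BKT log-Sobolev inequality (hypothesis), chart-flatness of `g` at `p`, the cone
factor `Λ = c ρ^{−(c+1)}` with `R_g Λ − 6 Δ_g Λ ≥ 0` off `p`, and the core floor at level `3 log c`, for
every `ε > 0` a smooth metric `G` on `M` with `R_G ≥ 0`, `R_G(p) > 0` and the entropy clause at level
`min (3 log c) (log 6 − 2) − ε`. -/
theorem stub_coneCapping : (∀ (P : Type) [TopologicalSpace P] [T2Space P] [SecondCountableTopology P] [ChartedSpace (EuclideanSpace ℝ (Fin 4)) P] [IsManifold (𝓡 4) ∞ P] [ConnectedSpace P] [T3Space P] [MeasurableSpace P] [BorelSpace P] (h : PseudoRiemannianMetric (𝓡 4) ∞ (EuclideanSpace ℝ (Fin 4)) (TangentSpace (𝓡 4) : P → Type _)) [h.HasLeviCivita] (hh : h.IsRiemannian) (θ : ℝ), (∀ (x : P) (r : NNReal), IsCompact {y : P | h.edist hh x y ≤ r}) → (∀ (x : P) (X : TangentSpace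 (𝓡 4) x), 0 ≤ h.ricci x X X) → 0 < θ → (∀ x : P, Tendsto (fun r : ℝ ↦ ((riemannianMeasure (h.toContMDiffRiemannianMetric hh)) {y : P | h.edist hh x y ≤ ENNReal.ofReal r}).toReal / (Real.pi ^ 2 / 2 * r ^ 4)) atTop (𝓝 θ)) → ∀ u : P → ℝ, ContMDiff (𝓡 4) 𝓘(ℝ, ℝ) ∞ u → HasCompactSupport u → ∫ x, (u x) ^ 2 ∂(riemannianMeasure (h.toContMDiffRiemannianMetric hh)) = 1 → ∀ τ : ℝ, 0 < τ → ∫ x, (u x) ^ 2 * Real.log ((u x) ^ 2) ∂(riemannianMeasure (h.toContMDiffRiemannianMetric hh)) ≤ 4 * τ * ∫ x, h.gradSq u x ∂(riemannianMeasure (h.toContMDiffRiemannianMetric hh)) - Real.log θ - 2 * Real.log (4 * Real.pi * τ) - 4) → ∀ (M : Type) [TopologicalSpace M] [T2Space M] [SecondCountableTopology M] [ChartedSpace (EuclideanSpace ℝ (Fin 4)) M] [IsManifold (𝓡 4) ∞ M] [CompactSpace M] [ConnectedSpace M] [T3Space M] [MeasurableSpace M] [BorelSpace M] (g : PseudoRiemannianMetric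 (𝓡 4) ∞ (EuclideanSpace ℝ (Fin 4)) (TangentSpace (𝓡 4) : M → Type _)) [g.HasLeviCivita] (hg : g.IsRiemannian) (p : M) (r : ℝ) (Λ : M → ℝ) (c : ℝ), (Metric.closedBall (extChartAt (𝓡 4) p p) r ⊆ (extChartAt (𝓡 4) p).target ∧ ∀ y ∈ Metric.closedBall (extChartAt (𝓡 4) p p) r, ∀ X W : EuclideanSpace ℝ (Fin 4), g.val ((extChartAt (𝓡 4) p).symm y) (mfderiv 𝓘(ℝ, EuclideanSpace ℝ (Fin 4)) (𝓡 4) (extChartAt (𝓡 4) p).symm y X) (mfderiv 𝓘(ℝ, EuclideanSpace ℝ (Fin 4)) (𝓡 4) (extChartAt (𝓡 4) p).symm y W) = ⟪X, W⟫) → (ContMDiffOn (𝓡 4) 𝓘(ℝ, ℝ) ∞ Λ {p}ᶜ ∧ (∀ x, x ≠ p → 0 < Λ x) ∧ ∀ y ∈ Metric.closedBall (extChartAt (𝓡 4) p p) r, y ≠ extChartAt (𝓡 4) p p → Λ ((extChartAt (𝓡 4) p).symm y) = c * ‖y - extChartAt (𝓡 4) p p‖ ^ (-(c + 1))) → 0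 < r → 0 < c → c ≤ 1 → (∀ x, x ≠ p → 0 ≤ g.scalarCurvature x * Λ x - 6 * g.dalembertian Λ x) → (∀ τ : ℝ, 0 < τ → ∀ w : M → ℝ, ContMDiff (𝓡 4) 𝓘(ℝ, ℝ) ∞ w → w =ᶠ[𝓝 p] 0 → ∫ x, (4 * Real.pi * τ) ^ (-(4 : ℝ) / 2) * (w x) ^ 2 * (Λ x) ^ 4 ∂(riemannianMeasure (g.toContMDiffRiemannianMetric hg)) = 1 → 3 * Real.log c ≤ ∫ x, (4 * τ * ((Λ x)⁻¹ ^ 2 * g.gradSq w x) - (w x) ^ 2 * Real.log ((w x) ^ 2) - 4 * (w x) ^ 2) * ((4 * Real.pi * τ) ^ (-(4 : ℝ) / 2) * (Λ x) ^ 4) ∂(riemannianMeasure (g.toContMDiffRiemannianMetric hg))) → ∀ ε : ℝ, 0 < ε → ∃ G : PseudoRiemannianMetric (𝓡 4) ∞ (EuclideanSpace ℝ (Fin 4)) (TangentSpace (𝓡 4) : M → Type _), ∃ _ : G.HasLeviCivita, ∃ hG : G.IsRiemannian, (∀ x : M, 0 ≤ G.scalarCurvature x) ∧ (∃ x : M,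 0 < G.scalarCurvature x) ∧ ∀ τ : ℝ, 0 < τ → ∀ f : M → ℝ, ContMDiff (𝓡 4) 𝓘(ℝ, ℝ) ∞ f → ∫ x, (4 * Real.pi * τ) ^ (-(4 : ℝ) / 2) * Real.exp (-f x) ∂(riemannianMeasure (G.toContMDiffRiemannianMetric hG)) = 1 → min (3 * Real.log c) (Real.log 6 - 2) - ε ≤ ∫ x, (τ * (G.scalarCurvature x + G.gradSq f x) + f x - 4) * ((4 * Real.pi * τ) ^ (-(4 : ℝ) / 2) * Real.exp (-f x)) ∂(riemannianMeasure (G.toContMDiffRiemannianMetric hG)) := by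
  intro hBKT M _ _ _ _ _ _ _ _ _ _ g _ hg p r Λ c hflat hcone hr hc hc1 hRΛ hfloor ε hε
  -- ══ Step R: a reference cap, for the (weight-uniform) Yamabe–Sobolev constant of the class ══
  have hr2 : (0 : ℝ) < r ^ 2 / 2 := by positivity
  obtain ⟨prof₀, A₀, a₀, sJ₀, sc₀, hprof₀s, -, -, hsJ₀, hsJc₀, hsc₀max, -, hcone₀, hpos₀, hRic₀,
    hderiv₀, -, -⟩ := helper_capProfile c hc hc1 1 one_pos 1 le_rfl (r ^ 2 / 2) hr2
  have hsc₀pos : 0 < sc₀ := hsJ₀.trans hsJc₀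
  have hsc₀r : sc₀ < r ^ 2 := by nlinarith [pow_pos hr 2]
  obtain ⟨Φ₀, hΦ₀s, hΦ₀pos, -, -, G₀, hLC₀, hG₀, hval₀, -, hRG₀, hRG₀p, -⟩ :=
    helper_capRealisation M g hg p r Λ c prof₀ sc₀ hflat hcone hr hc hRΛ hprof₀s hpos₀ hsc₀pos hsc₀r
      hcone₀ hRic₀ hderiv₀
  haveI := hLC₀
  obtain ⟨Y, hY, hSob⟩ :=
    helper_cappedSobolevUniform M g hg Φ₀ G₀ hG₀ hΦ₀s hΦ₀pos hval₀ hRG₀ ⟨p, hRG₀p⟩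
  -- ══ Step C: constants ══
  obtain ⟨C₀, hC₀, hcutFam⟩ := helper_cutoffFamily
  set ε' : ℝ := ε / 10 with hε'def
  have hε' : 0 < ε' := by positivity
  set κ₀ : ℝ := min (1 / 4) (ε' / 4) with hκ₀def
  have hκ₀pos : 0 < κ₀ := lt_min (by norm_num) (by positivity)
  have hκ₀le : κ₀ ≤ 1 / 4 := min_le_left _ _
  have hκ₀le' : κ₀ ≤ ε' / 4 := min_le_right _ _
  have hκ₀1 : κ₀ < 1 := by linarith
  obtain ⟨ℓ₀, Kc, V₀, hℓ₀, hKc0, hKc, hV₀0, hV₀, hsmall, hβle, hβhalf⟩ :=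
    ConeCappingParams.exists_constants hC₀ hY hε'
  have hℓ₀pos : 0 < ℓ₀ := by linarith
  set β : ℝ := 100 * Kc * Real.sqrt V₀ / Y with hβdef
  have hβnonneg : 0 ≤ β := by positivity
  have hβlt1 : β < 1 := by linarith
  set SV : ℝ := Real.sqrt (2 * Real.pi ^ 2 * (2 * ℓ₀ + 1) + 1) with hSVdef
  have hSVpos : 0 < SV := Real.sqrt_pos.2 (by positivity)
  set κ₁ : ℝ := min (min (min (ε' / (8 * (2 * ℓ₀ + 1))) (c * ε' / 6)) (min (c / 2) 1))
    (ε' * κ₀ * Y / (96 * SV)) with hκ₁def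
  have hκ₁pos : 0 < κ₁ := by
    rw [hκ₁def]
    refine lt_min (lt_min (lt_min (by positivity) (by positivity)) (lt_min (by positivity) one_pos)) ?_
    positivity
  have hκ₁a : κ₁ ≤ ε' / (8 * (2 * ℓ₀ + 1)) :=
    (min_le_left _ _).trans ((min_le_left _ _).trans (min_le_left _ _))
  have hκ₁b : κ₁ ≤ c * ε' / 6 := (min_le_left _ _).trans ((min_le_left _ _).trans (min_le_right _ _))
  have hκ₁c : κ₁ ≤ c / 2 := (min_le_left _ _).trans ((min_le_right _ _).trans (min_le_left _ _))
  have hκ₁d : κ₁ ≤ 1 := (min_le_left _ _).trans ((min_le_right _ _).trans (min_le_right _ _))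
  have hκ₁e : κ₁ ≤ ε' * κ₀ * Y / (96 * SV) := min_le_right _ _
  -- ══ Step P: the profile, with window `2ℓ₀ + 1` and `smax = r² e^{−6ℓ₀−4}` ══
  have hwin : (1 : ℝ) ≤ 2 * ℓ₀ + 1 := by linarith
  have hsmax : 0 < r ^ 2 * Real.exp (-6 * ℓ₀ - 4) := by positivity
  obtain ⟨prof, A, a, sJ, sc, hprofs, hA, ha, hsJ, hsJc, hscmax, hround, hconepr, hpos, hRic, hderiv,
    hslow, hrange⟩ := helper_capProfile c hc hc1 κ₁ hκ₁pos (2 * ℓ₀ + 1) hwin _ hsmax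
  have hscpos : 0 < sc := hsJ.trans hsJc
  have hscr : sc < r ^ 2 := by
    have h1 : Real.exp (-6 * ℓ₀ - 4) < 1 := by
      rw [← Real.exp_zero]; exact Real.exp_lt_exp.2 (by linarith)
    nlinarith [pow_pos hr 2]
  -- ══ Step G: realise `G = Φ² g` ══
  obtain ⟨Φ, hΦs, hΦpos, hΦchart, hΦΛ, G, hLC, hG, hval, hRform, hRnonneg, hRp, hRchart⟩ :=
    helper_capRealisation M g hg p r Λ c prof sc hflat hcone hr hc hRΛ hprofs hpos hscpos hscr
      hconepr hRic hderiv
  haveI := hLC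
  have hrGcont : Continuous G.scalarCurvature := G.contMDiff_scalarCurvature.continuous
  -- the class Sobolev inequality for the weight `Φ`, potential `R_G`
  have hSobΦ : ∀ u : M → ℝ, ContMDiff (𝓡 4) 𝓘(ℝ, ℝ) ∞ u →
      Y * Real.sqrt (∫ x, u x ^ 4 * Φ x ^ 4 ∂(riemannianMeasure (g.toContMDiffRiemannianMetric hg))) ≤
        ∫ x, (6 * (Φ x ^ 2 * g.gradSq u x) + G.scalarCurvature x * Φ x ^ 4 * u x ^ 2)
          ∂(riemannianMeasure (g.toContMDiffRiemannianMetric hg)) := by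
    intro u hu
    have h := hSob Φ hΦs hΦpos u hu
    have heq : ∫ x, (6 * (Φ x ^ 2 * g.gradSq u x) + G.scalarCurvature x * Φ x ^ 4 * u x ^ 2)
          ∂(riemannianMeasure (g.toContMDiffRiemannianMetric hg)) =
        ∫ x, (6 * (Φ x ^ 2 * g.gradSq u x)
            + Φ x * (g.scalarCurvature x * Φ x - 6 * g.dalembertian Φ x) * u x ^ 2)
          ∂(riemannianMeasure (g.toContMDiffRiemannianMetric hg)) := by
      refine integral_congr_ae (ae_of_all _ fun x ↦ ?_)
      have hΦx : Φ x ≠ 0 := (hΦpos x).ne'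
      simp only [hRform x]
      field_simp
    rw [heq]
    exact h
  -- ══ Step grid ══
  set T₀ : ℝ := Real.log sJ / 2 - ℓ₀ with hT₀def
  set N : ℕ := ⌈Real.log (sc / sJ) / 2 / ℓ₀⌉₊ + 3 with hNdef
  have hN2 : 2 ≤ N := by rw [hNdef]; omega
  have hgrid1 : Real.exp (T₀ + ((N : ℝ) - 1) * ℓ₀ + ℓ₀ + 1) < r :=
    ConeCappingParams.grid_chart hsJ hsJc hℓ₀ hr hscmax
  have hgrid0 : Real.exp (T₀ + ((N : ℝ) - 1) * ℓ₀ + ℓ₀) < r :=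
    lt_trans (Real.exp_lt_exp.2 (by linarith)) hgrid1
  have hcapend : Real.exp (T₀ + ℓ₀) ^ 2 = sJ := ConeCappingParams.grid_cap hsJ
  have hcoreStart : sc ≤ Real.exp (T₀ + ((N : ℝ) - 1) * ℓ₀) ^ 2 :=
    ConeCappingParams.grid_core hsJ hsJc hℓ₀
  -- ══ Step χ: the cut-off family ══
  obtain ⟨χ, hχs, hχsum, hsupp0, hsuppj, hsuppN, hgradzone, hgradbd, hzonevol⟩ :=
    hcutFam M g hg p r hflat hr ℓ₀ ℓ₀ T₀ N hℓ₀ le_rfl hN2 hgrid0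
  -- ══ Piece floors ══
  -- (cap) `R_G = 12/A²` on the round region `ρ² < s_J`
  have hcapS : ∀ x ∈ {x : M | x ∈ (extChartAt (𝓡 4) p).source ∧
      ‖extChartAt (𝓡 4) p x - extChartAt (𝓡 4) p p‖ ^ 2 < sJ}, G.scalarCurvature x = 12 / A ^ 2 := by
    rintro x ⟨hx, hρ⟩
    have hy : extChartAt (𝓡 4) p x ∈ Metric.ball (extChartAt (𝓡 4) p p) r := by
      rw [Metric.mem_ball, dist_eq_norm]
      exact lt_of_pow_lt_pow_left₀ 2 hr.le (hρ.trans (hsJc.trans hscr))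
    have h1 := hRchart _ hy
    rw [(extChartAt (𝓡 4) p).left_inv hx] at h1
    rw [h1]
    exact helper_roundProfileCurvature A a hA ha prof sJ hprofs hsJ hround _ (sq_nonneg _) hρ
  have hcapFloor := helper_capFloor M g hg p r Φ A a sJ hflat hr hA ha hsJ (hsJc.trans hscr)
    hΦs.continuous hΦpos (fun y hy hys ↦ by rw [hΦchart y hy, hround _ (sq_nonneg _) hys])
  have hcapPiece := helper_capPieceFloor M g hg Φ G.scalarCurvature A _ hΦs hΦpos hrGcont hA hcapS
    hcapFloor
  -- (core) `Φ = Λ` on the closed core region `S = {ρ ≥ t}`, `t = e^{T₀ + (N−1)ℓ₀} ≥ √s_c`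
  set t : ℝ := Real.exp (T₀ + ((N : ℝ) - 1) * ℓ₀) with htdef
  have htpos : 0 < t := by rw [htdef]; exact Real.exp_pos _
  have htr : t < r := by rw [htdef]; exact lt_trans (Real.exp_lt_exp.2 (by linarith)) hgrid0
  set Score : Set M := {x | x ∈ (extChartAt (𝓡 4) p).source →
    t ≤ ‖extChartAt (𝓡 4) p x - extChartAt (𝓡 4) p p‖} with hScore
  have hclS : closure Score = Score := (ConeCappingChart.isClosed_core p t).closure_eq
  have hpS : p ∉ Score := by
    intro h
    have := h (mem_extChartAt_source p)
    rw [sub_self, norm_zero] at this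
    linarith
  have hcoreEq : ∀ x ∈ closure Score, x ≠ p ∧ Φ x = Λ x := by
    intro x hx
    rw [hclS] at hx
    refine ⟨fun h ↦ hpS (h ▸ hx), ?_⟩
    by_contra hne
    obtain ⟨hxs, hρ⟩ := hΦΛ x hne
    have h1 := hx hxs
    nlinarith [mul_self_le_mul_self htpos.le h1]
  have hpcl : p ∉ closure Score := by rwa [hclS]
  have hcorePiece := helper_corePieceFloor M g hg p Λ Φ G.scalarCurvature c Score hΦs hΦpos hrGcont
    hRnonneg hcoreEq hpcl hfloor
  -- (annuli) the Euclidean exact-cone floor, from BKT on the smoothed cone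
  have hW3b := helper_annulusConeFloor hBKT helper_smoothedConeModel
  -- all pieces at the common level `min (3 log c − 4ε') (log 6 − 2)`
  set Lmin : ℝ := min (3 * Real.log c - 4 * ε') (Real.log 6 - 2) with hLmin
  have hpieces : ∀ (j : Fin (N + 1)) (σ : ℝ), 0 < σ → ∀ v : M → ℝ, ContMDiff (𝓡 4) 𝓘(ℝ, ℝ) ∞ v →
      (∀ x, v x ≠ 0 → χ j x ≠ 0) →
      ∫ x, (4 * Real.pi * σ) ^ (-(4 : ℝ) / 2) * (v x) ^ 2 * (Φ x) ^ 4
          ∂(riemannianMeasure (g.toContMDiffRiemannianMetric hg)) = 1 →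
        (fun _ : Fin (N + 1) ↦ Lmin) j ≤
          ∫ x, (σ * (G.scalarCurvature x * (v x) ^ 2 + 4 * ((Φ x)⁻¹ ^ 2 * g.gradSq v x))
            - (v x) ^ 2 * Real.log ((v x) ^ 2) - 4 * (v x) ^ 2)
            * ((4 * Real.pi * σ) ^ (-(4 : ℝ) / 2) * (Φ x) ^ 4)
          ∂(riemannianMeasure (g.toContMDiffRiemannianMetric hg)) := by
    intro j σ hσ v hv hvχ hnorm
    change Lmin ≤ _
    rcases Nat.eq_zero_or_pos (j : ℕ) with hj0 | hjpos
    · -- the cap piece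
      have hj : j = 0 := Fin.ext hj0
      subst hj
      refine le_trans (min_le_right _ _) (hcapPiece σ hσ v hv (fun x hx ↦ ?_) hnorm)
      obtain ⟨hxs, hρ⟩ := hsupp0 x (hvχ x hx)
      refine ⟨hxs, ?_⟩
      calc ‖extChartAt (𝓡 4) p x - extChartAt (𝓡 4) p p‖ ^ 2 < Real.exp (T₀ + ℓ₀) ^ 2 := by
            gcongr
        _ = sJ := hcapend
    rcases lt_or_eq_of_le (Nat.lt_succ_iff.1 j.isLt) with hjN | hjN
    · -- an annulus piece: window `[a e^{-1/2}, b e^{1/2}]`, slope read off at its bottom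
      set a : ℝ := Real.exp (T₀ + (((j : ℕ) : ℝ) - 1) * ℓ₀) with hadef
      set b : ℝ := Real.exp (T₀ + ((j : ℕ) : ℝ) * ℓ₀ + ℓ₀) with hbdef
      have hj1 : (1 : ℝ) ≤ ((j : ℕ) : ℝ) := by exact_mod_cast hjpos
      have hjN' : ((j : ℕ) : ℝ) + 1 ≤ (N : ℝ) := by exact_mod_cast hjN
      have hapos : 0 < a := by rw [hadef]; exact Real.exp_pos _
      have hab : a < b := by rw [hadef, hbdef]; exact Real.exp_lt_exp.2 (by nlinarith)
      have hbr : b * Real.exp (1 / 2) < r := by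
        refine lt_of_le_of_lt ?_ hgrid1
        rw [hbdef, ← Real.exp_add]
        exact Real.exp_le_exp.2 (by nlinarith)
      set s₁ : ℝ := (a * Real.exp (-(1 / 2))) ^ 2 with hs₁def
      have hs₁ : s₁ = Real.exp (2 * (T₀ + (((j : ℕ) : ℝ) - 1) * ℓ₀) + 2 * (-(1 / 2))) := by
        rw [hs₁def, hadef, exp_mul_exp_sq]
      have hs₁low : sJ * Real.exp (-2 * (2 * ℓ₀ + 1)) ≤ s₁ := by
        rw [hs₁, show sJ * Real.exp (-2 * (2 * ℓ₀ + 1)) = Real.exp (Real.log sJ + -2 * (2 * ℓ₀ + 1)) by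
          rw [Real.exp_add, Real.exp_log hsJ]]
        exact Real.exp_le_exp.2 (by rw [hT₀def]; nlinarith)
      have htop : (b * Real.exp (1 / 2)) ^ 2 = s₁ * Real.exp (2 * (2 * ℓ₀ + 1)) := by
        rw [hbdef, exp_mul_exp_sq, hs₁, ← Real.exp_add]
        congr 1; ring
      set c' : ℝ := -(2 * s₁ * deriv prof s₁ / prof s₁) - 1 with hc'def
      obtain ⟨hQlo, hQhi⟩ := hrange s₁ hs₁low
      have hc'1 : c' ≤ 1 := by rw [hc'def]; linarith
      have hc'low : c - κ₁ ≤ c' := by rw [hc'def]; linarith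
      have hc'pos : 0 < c' := by linarith
      have hslope : ∀ s, (a * Real.exp (-(1 / 2))) ^ 2 ≤ s → s ≤ (b * Real.exp (1 / 2)) ^ 2 →
          |2 * s * deriv prof s / prof s + (c' + 1)| ≤ κ₁ := by
        intro s hs1 hs2
        have h := hslow s₁ s hs₁low hs1 (by rw [← htop]; exact hs2)
        rw [abs_sub_comm] at h
        rw [hc'def]
        convert h using 2
        ring
      have hAP := helper_annulusPiece hW3b M g hg p r Φ G.scalarCurvature prof c' a b κ₀ κ₁ Y hflat hr
        hprofs hpos hΦs hΦpos hΦchart hrGcont hRnonneg hc'pos hc'1 hapos hab hbr hκ₀pos hκ₀1 hκ₁pos.le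
        hY hslope hSobΦ σ hσ v hv (fun x hx ↦ hsuppj j x hjpos hjN (hvχ x hx)) hnorm
      have hlogba : Real.log (b / a) = 2 * ℓ₀ := by
        rw [hbdef, hadef, ← Real.exp_sub, Real.log_exp]; ring
      rw [hlogba] at hAP
      have hlev := helper_coneCapping_annulusLevel c ε' κ₀ κ₁ ℓ₀ Y c' hc hε' hκ₀pos hκ₀le hκ₀le' hY
        hℓ₀ hκ₁pos.le hκ₁a hκ₁b hκ₁c hκ₁d hκ₁e hc'low
      exact le_trans (min_le_left _ _) (hlev.trans hAP)
    · -- the core piece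
      have hj : j = Fin.last N := Fin.ext hjN
      refine le_trans ?_ (hcorePiece σ hσ v hv (fun x hx hxs ↦ ?_) hnorm)
      · exact le_trans (min_le_left _ _) (by linarith)
      · have h := hsuppN x (hj ▸ hvχ x hx) hxs
        by_cases hρr : ‖extChartAt (𝓡 4) p x - extChartAt (𝓡 4) p p‖ < r
        · exact (h hρr).le
        · push Not at hρr
          exact htr.le.trans hρr
  -- ══ Zones, the radial weight `ϖ`, and the absorption of the cut-off cost ══
  set Z : Fin N → Set M := fun i ↦ {x | x ∈ (extChartAt (𝓡 4) p).source ∧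
    Real.exp (T₀ + ((i : ℕ) : ℝ) * ℓ₀) ≤ ‖extChartAt (𝓡 4) p x - extChartAt (𝓡 4) p p‖ ∧
    ‖extChartAt (𝓡 4) p x - extChartAt (𝓡 4) p p‖ ≤ Real.exp (T₀ + ((i : ℕ) : ℝ) * ℓ₀ + ℓ₀)} with hZdef
  set ϖ : M → ℝ := {x | x ∈ (extChartAt (𝓡 4) p).source ∧
      Real.exp (T₀ - 1) < ‖extChartAt (𝓡 4) p x - extChartAt (𝓡 4) p p‖ ∧
      ‖extChartAt (𝓡 4) p x - extChartAt (𝓡 4) p p‖ < r}.indicator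
    (fun x ↦ ‖extChartAt (𝓡 4) p x - extChartAt (𝓡 4) p p‖⁻¹) with hϖdef
  have hϖmeas : Measurable ϖ := ConeCappingChart.measurable_varpi p (Real.exp_pos _).le
  have hϖnn : ∀ x, 0 ≤ ϖ x := ConeCappingChart.varpi_nonneg p _ _
  have hZmeas : ∀ i, MeasurableSet (Z i) := fun i ↦
    ConeCappingChart.measurableSet_annulus_closed p _ _
  have hZtop : ∀ i : Fin N, Real.exp (T₀ + ((i : ℕ) : ℝ) * ℓ₀ + ℓ₀) ≤
      Real.exp (T₀ + ((N : ℝ) - 1) * ℓ₀ + ℓ₀) := by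
    intro i
    have : ((i : ℕ) : ℝ) + 1 ≤ (N : ℝ) := by exact_mod_cast i.isLt
    exact Real.exp_le_exp.2 (by nlinarith)
  have hZr : ∀ (i : Fin N) (x : M), x ∈ Z i → ‖extChartAt (𝓡 4) p x - extChartAt (𝓡 4) p p‖ < r :=
    fun i x hx ↦ lt_of_le_of_lt (hx.2.2.trans (hZtop i)) hgrid0
  have hZϖ : ∀ (i : Fin N) (x : M), x ∈ Z i → ϖ x = ‖extChartAt (𝓡 4) p x - extChartAt (𝓡 4) p p‖⁻¹ := by
    intro i x hx
    refine ConeCappingChart.varpi_eq_of_mem p hx.1 (lt_of_lt_of_le (Real.exp_lt_exp.2 ?_) hx.2.1)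
      (hZr i x hx)
    have : (0 : ℝ) ≤ ((i : ℕ) : ℝ) := Nat.cast_nonneg _
    nlinarith
  have hZvol : ∀ i : Fin N, ∫ x in Z i, ϖ x ^ 4
      ∂(riemannianMeasure (g.toContMDiffRiemannianMetric hg)) ≤ V₀ := by
    intro i
    calc ∫ x in Z i, ϖ x ^ 4 ∂(riemannianMeasure (g.toContMDiffRiemannianMetric hg))
        = ∫ x in Z i, (‖extChartAt (𝓡 4) p x - extChartAt (𝓡 4) p p‖ ^ 4)⁻¹
            ∂(riemannianMeasure (g.toContMDiffRiemannianMetric hg)) :=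
          setIntegral_congr_fun (hZmeas i) (fun x hx ↦ by simp only [hZϖ i x hx, inv_pow])
      _ ≤ 2 * Real.pi ^ 2 * ℓ₀ + 1 := hzonevol i i.isLt
      _ ≤ V₀ := hV₀
  have hZint : ∀ i : Fin N, IntegrableOn (fun x ↦ ϖ x ^ 4) (Z i)
      (riemannianMeasure (g.toContMDiffRiemannianMetric hg)) := by
    intro i
    have h := helper_cutoffFamily_zoneIntegrable M g hg p r hflat (Real.exp (T₀ + ((i : ℕ) : ℝ) * ℓ₀))
      (Real.exp (T₀ + ((i : ℕ) : ℝ) * ℓ₀ + ℓ₀)) (Real.exp_pos _) ((hZtop i).trans hgrid0.le)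
    exact h.congr_fun (fun x hx ↦ by simp only [hZϖ i x hx, inv_pow]) (hZmeas i)
  have hgradZone : ∀ (j : Fin (N + 1)) (x : M), g.gradSq (χ j) x ≠ 0 →
      ∃ i : Fin N, ((i : ℕ) = (j : ℕ) ∨ (i : ℕ) + 1 = (j : ℕ)) ∧ x ∈ Z i := by
    intro j x hx
    obtain ⟨hxs, i, hiN, hij, h1, h2⟩ := hgradzone j x hx
    exact ⟨⟨i, hiN⟩, hij, hxs, h1, h2⟩
  have hzoneAdj : ∀ (i : Fin N) (x : M), x ∈ Z i → ∀ j : Fin (N + 1), χ j x ≠ 0 →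
      ((j : ℕ) = (i : ℕ) ∨ (j : ℕ) = (i : ℕ) + 1) := by
    rintro i x hx j hj
    refine helper_coneCapping_zoneAdjacency T₀ ℓ₀ _ N i j hℓ₀pos i.isLt (Nat.lt_succ_iff.1 j.isLt)
      hx.2.1 hx.2.2 (fun hj0 ↦ ?_) (fun hjpos hjN ↦ (hsuppj j x hjpos hjN hj).2) (fun hjN ↦ ?_)
    · have hj0' : j = 0 := Fin.ext hj0
      subst hj0'
      exact (hsupp0 x hj).2
    · have hj' : j = Fin.last N := Fin.ext hjN
      exact hsuppN x (hj' ▸ hj) hx.1 (hZr i x hx)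
  have hgradBound : ∀ x : M, ∑ j, g.gradSq (χ j) x ≤ Kc * ϖ x ^ 2 := by
    intro x
    by_cases hall : ∀ j, g.gradSq (χ j) x = 0
    · simp only [hall, Finset.sum_const_zero]; positivity
    push Not at hall
    obtain ⟨j₀, hj₀⟩ := hall
    obtain ⟨i₀, -, hxZ⟩ := hgradZone j₀ x hj₀
    have hϖx := hZϖ i₀ x hxZ
    have hρpos : 0 < ‖extChartAt (𝓡 4) p x - extChartAt (𝓡 4) p p‖ :=
      lt_of_lt_of_le (Real.exp_pos _) hxZ.2.1
    have hB : 0 ≤ C₀ / (ℓ₀ ^ 2 * ‖extChartAt (𝓡 4) p x - extChartAt (𝓡 4) p p‖ ^ 2) := by positivity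
    have hsum := ConeCappingParams.sum_le_four_mul (fun j ↦ g.gradSq (χ j) x)
      (C₀ / (ℓ₀ ^ 2 * ‖extChartAt (𝓡 4) p x - extChartAt (𝓡 4) p p‖ ^ 2)) i₀ hB
      (fun j ↦ hgradbd j x hxZ.1) (fun j hj ↦ ?_)
    · calc ∑ j, g.gradSq (χ j) x
          ≤ 4 * (C₀ / (ℓ₀ ^ 2 * ‖extChartAt (𝓡 4) p x - extChartAt (𝓡 4) p p‖ ^ 2)) := hsum
        _ = (4 * C₀ / ℓ₀ ^ 2) * ‖extChartAt (𝓡 4) p x - extChartAt (𝓡 4) p p‖⁻¹ ^ 2 := by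
            field_simp
        _ ≤ Kc * ϖ x ^ 2 := by
            rw [hϖx]; exact mul_le_mul_of_nonneg_right hKc (by positivity)
    · obtain ⟨i, hij, hxZi⟩ := hgradZone j x hj
      have h1 : ((i : ℕ) : ℝ) ≤ ((i₀ : ℕ) : ℝ) + 1 :=
        le_of_exp_grid_le hℓ₀pos (hxZi.2.1.trans hxZ.2.2)
      have h2 : ((i₀ : ℕ) : ℝ) ≤ ((i : ℕ) : ℝ) + 1 :=
        le_of_exp_grid_le hℓ₀pos (hxZ.2.1.trans hxZi.2.2)
      have h1' : (i : ℕ) ≤ (i₀ : ℕ) + 1 := by exact_mod_cast h1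
      have h2' : (i₀ : ℕ) ≤ (i : ℕ) + 1 := by exact_mod_cast h2
      omega
  have habsorb := helper_cutoffAbsorptionI M g hg Φ G.scalarCurvature ϖ N χ Z Kc V₀ Y hΦs hΦpos hrGcont
    hRnonneg hϖmeas hϖnn hχs hχsum hZmeas hKc0 hV₀0 hY hgradZone hzoneAdj hgradBound hZvol hZint hSobΦ
    hsmall
  -- ══ Localisation and the dictionary ══
  have hL1 := helper_localisationPrinciple M g hg Φ G.scalarCurvature N χ (fun _ ↦ Lmin) β hΦs hΦpos
    hrGcont hRnonneg hχs hχsum hβnonneg hβlt1 habsorb hpieces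
  have hlevel : min (3 * Real.log c) (Real.log 6 - 2) - ε ≤
      Finset.univ.inf' Finset.univ_nonempty (fun _ : Fin (N + 1) ↦ Lmin) + 2 * Real.log (1 - β) := by
    rw [Finset.inf'_const]
    have hlog := GluingConstants.neg_two_mul_le_log_one_sub hβnonneg hβhalf
    have hm : min (3 * Real.log c) (Real.log 6 - 2) - 4 * ε' ≤ Lmin := by
      rw [hLmin, le_min_iff]
      constructor
      · linarith [min_le_left (3 * Real.log c) (Real.log 6 - 2)]
      · linarith [min_le_right (3 * Real.log c) (Real.log 6 - 2)]
    have hε10 : ε = 10 * ε' := by rw [hε'def]; ring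
    rw [hε10]
    linarith
  have hdict := helper_clauseDictionary M g hg Φ G hG (min (3 * Real.log c) (Real.log 6 - 2) - ε)
    hΦs hΦpos hval (fun τ hτ w hw _ hn ↦ hlevel.trans (hL1 τ hτ w hw hn))
  exact ⟨G, hLC, hG, hRnonneg, ⟨p, hRp⟩, hdict⟩

end Summit.SmoothPoincare4.SmoothPoincare4.Theorems

end
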